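import Summits.QuantumFields.YangMills.Theorems.ColdExitSC.Negative.UniformExitFalseOfFemtoTowerRep

/-!
# `UniformExitAt θ` is false of the femto tower — file 2∕2: CLASS LEVEL (the stub `FemtoTowerSC`, the refuted strengthening `UniformExitAt θ` of the
# seed `E = BasinRung.ColdExitAt θ` of crux `IR` (stmt-QuantumFields-19354), the sharp threshold `uniformExitAt_iff_one_le`, the selector theorem)

See `UniformExitFalseOfFemtoTowerRep.lean` (file 1∕2) for the module documentation, §0–§3 and the reading; authored by ideator ym-ir-idea-10 g2
(line `femto-wall`), landed by the LEAD prover ab-p1 in the Negative lane (critic ym-ir-crit-3 co-sign 06:03:05Z).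

HONEST FRAMING.  Nothing here proves the Yang–Mills mass gap (Clay), the crux `BalabanLadder.IR`, or `E`; every statement is proved outright or from the
explicit hypotheses `FemtoTowerSC` ∕ `CentreFluxImpuritySU2`; R4 closes only the conditional finite-𝕋⁴ rung `BalabanLadder.UV`.
-/

set_option autoImplicit false

noncomputable section

open Filter Topology MeasureTheory
open Literature.MathematicalPhysics.QuantumFieldTheory Literature.MathematicalPhysics.QuantumLattice
open Summit.QuantumFields.YangMills.Cruxes.IR.ColdPurityBridge (coldDefect)
open Summit.QuantumFields.YangMills.Cruxes.IR.AspectBootstrap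
  (HasSpectralDatum exc phi exc_nonneg exc_antitone z_eq_exp_mul z_pos tracePositive)
open Summit.QuantumFields.YangMills.Cruxes.IR.BasinRung (ColdExitAt coldExitAt_mono)

namespace Summit.QuantumFields.YangMills.Theorems.ColdExitSC.Negative.FemtoWall

/-! ## §4 Class level: the stub, the refuted strengthening of the seed, the selector theorem for `E` -/

/-- **STUB `FemtoTowerSC` — the femto tower for every compact simple `G`** (NO simply-connectedness binder: the phenomenon is
group-blind within compact connected Lie groups — `SO(3)`, `U(1)×…` alike; it USES connectedness / positive dimension, which
`IsCompactSimpleLieGroup` guarantees; FALSE for finite groups).  Route-posited obligation; physics-certain; the tree has the transfer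
matrix (`tracePositive`) but not yet the Laplace/zero-mode asymptotics of `wilsonFinTorusPartition` at fixed volume.
Why it might fail: only through a mis-typing (it cannot fail for `dim G ≥ 1` if the femto-universe spectrum is what every weak-coupling
analysis says); the honest risk is PROVABILITY (singular strata of the commuting variety enter the Laplace exponent — they change the
rate, not the divergence).  Sources: Luscher1983 (NPB 219, 233), vanBaalKoller1987, CosteEtAl1985 (NPB 262, 67), GonzalezArroyoKorthalsAltes1988. -/
def FemtoTowerSC : Prop :=
  ∀ (G : Type) [Group G] [TopologicalSpace G] [IsTopologicalGroup G] [CompactSpace G],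
    IsCompactSimpleLieGroup G →
    letI : MeasurableSpace G := borel G
    haveI : BorelSpace G := ⟨rfl⟩
    ∀ r : LatticeRep G, FemtoTowerAt r

/-- **`UniformExitAt θ` — the seed `ColdExitAt θ` with the quantifiers `∃ L` / `∀ β` SWAPPED** (box before coupling), on `E`'s own
class (compact simple simply-connected `G`, every lattice representation).  A strengthening of the seed (`coldExitAt_of_uniformExitAt`);
FALSE for every `θ < 1` modulo `FemtoTowerSC` (`not_uniformExitAt_SU2`).  Route-posited NEGATIVE target, not a published statement. -/
def UniformExitAt (θ : ℝ) : Prop :=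
  ∀ (G : Type) [Group G] [TopologicalSpace G] [IsTopologicalGroup G] [CompactSpace G],
    IsCompactSimpleLieGroup G → SimplyConnectedSpace G →
    letI : MeasurableSpace G := borel G
    haveI : BorelSpace G := ⟨rfl⟩
    ∀ r : LatticeRep G, UniformExitAtRep r θ

/-- The β-uniform form at the desk's tolerance of record `1/24` (closed Prop for the tautology probe). -/
def UniformExit24 : Prop := UniformExitAt (1 / 24)

/-- `UniformExitAt θ` IS a strengthening of the seed `ColdExitAt θ` (swap the quantifiers back). -/
theorem coldExitAt_of_uniformExitAt {θ : ℝ} (h : UniformExitAt θ) : ColdExitAt θ := by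
  intro G _ _ _ _ hG hsc
  letI : MeasurableSpace G := borel G
  haveI : BorelSpace G := ⟨rfl⟩
  intro r
  obtain ⟨L, hL, β₁, hβ₁⟩ := h G hG hsc r
  exact ⟨β₁, fun β hβ => ⟨L, hL, hβ₁ β hβ⟩⟩

/-- **The strengthening is refuted at `SU(2)`** (PROVED modulo the stub `FemtoTowerSC` and the binder fact `π₁(SU(2)) = 1`, i.e.
`SU(2) ≅ S³`, Bröcker–tom Dieck V (7.13) — not in the tree, carried as a hypothesis): for every `θ < 1`, `¬ UniformExitAt θ`. -/
theorem not_uniformExitAt_SU2 (hF : FemtoTowerSC)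
    (hsc : SimplyConnectedSpace (Matrix.specialUnitaryGroup (Fin 2) ℂ)) {θ : ℝ} (hθ : θ < 1) :
    ¬ UniformExitAt θ := by
  intro hU
  have hG : IsCompactSimpleLieGroup (Matrix.specialUnitaryGroup (Fin 2) ℂ) :=
    isCompactSimpleLieGroup_specialUnitaryGroup isSimpleCompactGroup_specialUnitaryGroup_holds le_rfl
  letI : MeasurableSpace (Matrix.specialUnitaryGroup (Fin 2) ℂ) := borel _
  haveI : BorelSpace (Matrix.specialUnitaryGroup (Fin 2) ℂ) := ⟨rfl⟩
  have hUr : UniformExitAtRep (fundamentalLatticeRep 2) θ := hU _ hG hsc (fundamentalLatticeRep 2)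
  have hFr : FemtoTowerAt (fundamentalLatticeRep 2) := hF _ hG (fundamentalLatticeRep 2)
  exact not_uniformExitAtRep _ (eventualImpurityAt_of_femto _ (femtoImpurityAt_of_tower _ hFr) hθ) hUr

/-- **Trivial side, class level (PROVED):** `UniformExitAt θ` for every `θ ≥ 1`, hence `ColdExitAt θ` for `θ ≥ 1` outright (group-blind). -/
theorem uniformExitAt_of_one_le {θ : ℝ} (hθ : 1 ≤ θ) : UniformExitAt θ := by
  intro G _ _ _ _ hG hsc
  letI : MeasurableSpace G := borel G
  haveI : BorelSpace G := ⟨rfl⟩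
  intro r
  exact uniformExitAtRep_of_one_le r hθ

-- The trivial range of the seed outright, `1 ≤ θ → BasinRung.ColdExitAt θ`, is ALREADY LANDED as
-- `Summit.QuantumFields.YangMills.Cruxes.IR.BasinRung.Negative.coldExitAt_of_one_le`
-- (`Theorems/IR/Negative/ColdExitAtVacuityThreshold.lean`); not restated here (it also follows as
-- `coldExitAt_of_uniformExitAt (uniformExitAt_of_one_le hθ)`).

/-- **SHARP THRESHOLD on the tolerance axis (PROVED modulo `FemtoTowerSC` + `π₁(SU(2)) = 1`): `UniformExitAt θ ↔ 1 ≤ θ`.**  The seed with the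
box chosen before the coupling holds exactly in the trivial range — the wall is optimal in `θ`. -/
theorem uniformExitAt_iff_one_le (hF : FemtoTowerSC)
    (hsc : SimplyConnectedSpace (Matrix.specialUnitaryGroup (Fin 2) ℂ)) {θ : ℝ} :
    UniformExitAt θ ↔ 1 ≤ θ :=
  ⟨fun h => not_lt.mp fun hθ => not_uniformExitAt_SU2 hF hsc hθ h, uniformExitAt_of_one_le⟩

/-- **`UniformExit24` is refuted already by the centre rung** (PROVED modulo `CentreFluxImpuritySU2` and `π₁(SU(2)) = 1`): the eight
electric-flux sectors of `SU(2)` suffice at the desk's tolerance `1/24 < 7/8`; the full tower is not needed for the headline. -/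
theorem not_uniformExit24_of_centreRung (hC : CentreFluxImpuritySU2)
    (hsc : SimplyConnectedSpace (Matrix.specialUnitaryGroup (Fin 2) ℂ)) : ¬ UniformExit24 := by
  intro hU
  have hG : IsCompactSimpleLieGroup (Matrix.specialUnitaryGroup (Fin 2) ℂ) :=
    isCompactSimpleLieGroup_specialUnitaryGroup isSimpleCompactGroup_specialUnitaryGroup_holds le_rfl
  letI : MeasurableSpace (Matrix.specialUnitaryGroup (Fin 2) ℂ) := borel _
  haveI : BorelSpace (Matrix.specialUnitaryGroup (Fin 2) ℂ) := ⟨rfl⟩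
  have hUr : UniformExitAtRep (fundamentalLatticeRep 2) (1 / 24) := hU _ hG hsc (fundamentalLatticeRep 2)
  exact not_uniformExitAtRep _ (hC (1 / 24) (by norm_num)) hUr

/-- **The selector theorem for the seed** (PROVED modulo `FemtoTowerSC`): on `E`'s class, if `ColdExitAt θ` holds with `θ < 1`
then at every `(G, r)` there IS a selector and EVERY selector `β ↦ L(β)` (eventually `8 ≤ L(β)`, `δᶜ_β(L(β)) ≤ θ`) tends to `+∞`:
the witnesses of `E` diverge in lattice units — a unit map / multi-scale passage is forced on any proof of `E`. -/
theorem exitSelectors_diverge (hF : FemtoTowerSC) {θ : ℝ} (hθ : θ < 1) (hE : ColdExitAt θ)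
    (G : Type) [Group G] [TopologicalSpace G] [IsTopologicalGroup G] [CompactSpace G]
    (hG : IsCompactSimpleLieGroup G) (hsc : SimplyConnectedSpace G) :
    letI : MeasurableSpace G := borel G
    haveI : BorelSpace G := ⟨rfl⟩
    ∀ r : LatticeRep G,
      (∃ f : ℝ → ℕ, ∀ᶠ β : ℝ in atTop, 8 ≤ f β ∧ coldDefect r.ρ β (f β) ≤ θ) ∧
      ∀ f : ℝ → ℕ, (∀ᶠ β : ℝ in atTop, 8 ≤ f β ∧ coldDefect r.ρ β (f β) ≤ θ) → Tendsto f atTop atTop := by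
  letI : MeasurableSpace G := borel G
  haveI : BorelSpace G := ⟨rfl⟩
  intro r
  have hFr : FemtoImpurityAt r := femtoImpurityAt_of_tower r (hF G hG r)
  refine ⟨?_, fun f hf => selector_tendsto_atTop r (eventualImpurityAt_of_femto r hFr hθ) f hf⟩
  obtain ⟨β₁, hβ₁⟩ := hE G hG hsc r
  classical
  refine ⟨fun β => if h : β₁ ≤ β then (hβ₁ β h).choose else 8, ?_⟩
  filter_upwards [eventually_ge_atTop β₁] with β hβ
  simp only [dif_pos hβ]
  exact (hβ₁ β hβ).choose_spec

/-- **No upward heredity on the class** (PROVED modulo `FemtoTowerSC`): given the seed `ColdExitAt θ`, at every `(G, r)` of `E`'s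
class and every `ε' < 1`, `¬ UpwardHeredityAtRep r θ ε'`. -/
theorem not_upwardHeredity_of_exitAt (hF : FemtoTowerSC) {θ ε' : ℝ} (hε' : ε' < 1) (hE : ColdExitAt θ)
    (G : Type) [Group G] [TopologicalSpace G] [IsTopologicalGroup G] [CompactSpace G]
    (hG : IsCompactSimpleLieGroup G) (hsc : SimplyConnectedSpace G) :
    letI : MeasurableSpace G := borel G
    haveI : BorelSpace G := ⟨rfl⟩
    ∀ r : LatticeRep G, ¬ UpwardHeredityAtRep r θ ε' := by
  letI : MeasurableSpace G := borel G
  haveI : BorelSpace G := ⟨rfl⟩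
  intro r
  have hFr : FemtoImpurityAt r := femtoImpurityAt_of_tower r (hF G hG r)
  refine not_upwardHeredity r (eventualImpurityAt_of_femto r hFr hε') fun β₁ => ?_
  obtain ⟨β₀, hβ₀⟩ := hE G hG hsc r
  obtain ⟨L, hL, hδ⟩ := hβ₀ (max β₀ β₁) (le_max_left _ _)
  exact ⟨max β₀ β₁, le_max_right _ _, L, hL, hδ⟩

end Summit.QuantumFields.YangMills.Theorems.ColdExitSC.Negative.FemtoWall

end
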